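import Summits.BirchSwinnertonDyer.BirchSwinnertonDyer.Theorems.InertBadSignedBranchesCccOneLawOnTypeIstarZeroOffMuComparison
import Summits.BirchSwinnertonDyer.Rank1Residual.Additive.KatoDescentAdmissibleIstarZero
import HarnessLib

set_option linter.dupNamespace false
set_option autoImplicit false

/-!
# `CccOneLawOnTypeIstarZero` (stmt-BirchSwinnertonDyer-19223), line `kato_perrin_riou_istar` v15 —
# the CONVERSE of the off-`μ` comparison: `ι`-symmetry of `X₀(W/ℚ_∞)` off `(p)` ⟹ stub 2c-T1's proportionality

Refill hand `leafhand-bsd-inertbadsignedbran-8` g0 (prover), 2026-08-31; DEF-FREE helper `--supports 19223 --as helper`, companion of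
`…Theorems.InertBadSignedBranchesCccOneLawOnTypeIstarZeroOffMuComparison` (same hand; §1–§4 there).  Skeleton of record
`Cruxes/CccOneLawOnTypeIstarZero/Lines/kato_perrin_riou_istar.lean` v15, sha16 `1c7e623d6cf61178`.  Nothing is registered, no stub
is closed; the published inputs (19867 `PublishedInputsEtaUpToP`, BT26-for-`W` `Kato2004.BurungaleTian2026_lengthEq_offMu_of_hasCM`,
the Kobayashi package fact, F-CM, GZK — all conjuncts of the line's PRINT stubs 5 / 6b) are HYPOTHESES.  BSD is proved for no curve.

## What this file proves (kernel)

The companion file showed (§3/§4 there): stub 2c-T1's `p`-power proportionality `(p:Λ)^a • P.z = (p:Λ)^b • z₁` of Kobayashi's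
`η`-class and an admissible Kato class FORCES the `ι`-symmetry `ℓ_𝔮(X₀) = ℓ_{ι𝔮}(X₀)` of the dual fine Selmer module
`X₀(W/ℚ_∞)` at every height-one prime `𝔮 ≠ (p)`.  Here the CONVERSE:

* §1 `exists_pow_smul_eq_units_mul_pow_smul_of_lengthAt_eq` (element-level, any pin with `rank_Λ 𝐇¹_Γ = 1`): two non-zero
  classes whose cyclic quotients have the same local lengths at every height-one `𝔮 ∌ p` are `p^ℤ·Λˣ`-PROPORTIONAL —
  a collinearity `F • z = G • z₀` (`CccOneCollinearMu.exists_collinear_ne_zero`), the collinearity identity off `(p)`, the UFD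
  dictionary `Module.charIdeal_mul_span_pow_eq_of_lengthAt_eq` (`(F)·(p)^i = (G)·(p)^{i'}`, so `F·p^i·u = G·p^{i'}`), and
  torsion-freeness of `𝐇¹_Γ`.
* §2 `exists_admissible_pow_smul_eq_of_fine_comap_invol` (the `η`-frame): granted 19867 + BT26-for-`W`, the `ι`-symmetry of
  `X₀(FB)` off `(p)` + `rank_Λ 𝐇¹_Γ = 1` + ONE admissible class on the pin give an ADMISSIBLE `z₁` and `a b` with
  `(p:Λ)^a • P.z = (p:Λ)^b • z₁` (the unit absorbed by `IsAdmissibleZetaClass.units_smul`).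
* §3 `stub2cT1_at_of_fine_comap_invol_onType_IstarZero` (the rows `(p, I₀*)`, `p ≥ 5`, analytic rank one): granted the line's
  print conjuncts (package fact, F-CM, GZK, BT26-for-`W`, 19867), the `ι`-symmetry of `X₀(W/ℚ_∞)` off `(p)` gives stub 2c-T1's
  registered conclusion AT EVERY PIN.  With §4 of the companion: **on this line, granted its print stub, stub 2c-T1 ⟺ the
  `ι`-symmetry of `char X₀(W/ℚ_∞) ⊗ ℚ` on the rows** (Greenberg-type functional-equation content; print status in the census
  of this hand) — a candidate RESHAPE of 2c-T1 into a statement about one standard Iwasawa module of `W`, no package / class /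
  `η`-frame in it (§4 `stub2cT1_iff_fine_comap_invol_onType_IstarZero` packages the `iff`).  The `μ`-part (stub 2c-T2, `a = b`)
  is untouched.

Honest label: bookkeeping only; closes no stub; 19223 stays OPEN.
References: [Kato2004Asterisque] Thm. 12.4 (2), Thm. 12.5 (1) (p. 221), Conj. 12.10 (p. 224), Prop. 15.21 (p. 266);
[Kobayashi2003] Thm. 6.2–6.3 (p. 11), Thm. 7.3 i), Cor. 7.2, proof of Thm. 7.4 (p. 13); [BurungaleTian2026] Thm. 2.6 (p. 5);
[Greenberg1989] §0 (pp. 101–102); [Washington1997] §13.2; [NeukirchSchmidtWingberg2008] Ch. V §3; [Darmon2004] Thm. 3.22.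
-/

noncomputable section

open scoped Classical

open CongruenceSubgroup WeierstrassCurve Field Literature.NumberTheory.EllipticCurves
  Literature.NumberTheory.EllipticCurves.ModularForms Literature.NumberTheory.EllipticCurves.IwasawaAlgebra
  Literature.NumberTheory.EllipticCurves.Kato2004 ZpExtension
  Summit.BirchSwinnertonDyer.BirchSwinnertonDyer.Theses.InertBadSignedBranches
  Summit.BirchSwinnertonDyer.Rank1Residual
  Summit.BirchSwinnertonDyer.BirchSwinnertonDyer.Theorems.CccOneOffMuComparison

namespace Summit.BirchSwinnertonDyer.BirchSwinnertonDyer.Theorems.CccOneOffMuComparisonConverse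

variable {p : ℕ} [Fact p.Prime]

/-! ## §1 Element level: equal lengths off `(p)` in a rank-one `𝐇¹_Γ` ⟹ `p^ℤ·Λˣ`-proportionality -/

section H1

variable {W : WeierstrassCurve ℚ} [W.IsElliptic] [ContinuousSMul ℤ_[p] (W.tateModule p)]
  {K : ZpExtension ℚ p} {γ : absoluteGaloisGroup ℚ} (I : IwasawaH1Data W p K γ)

/-- **Equal local lengths away from `(p)` + `rank_Λ 𝐇¹_Γ = 1` ⟹ a `p`-power proportionality up to `Λˣ`** (kernel):
for non-zero `z, z₀ ∈ 𝐇¹_Γ(T_pW)` (torsion-free, `Λ`-rank one, `K` cyclotomic) with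
`ℓ_𝔮(𝐇¹_Γ ⧸ Λ∙z) = ℓ_𝔮(𝐇¹_Γ ⧸ Λ∙z₀)` at every height-one `𝔮 ∌ p`, there are `u ∈ Λˣ` and `a b : ℕ` with
`(p:Λ)^a • z = (u·(p:Λ)^b) • z₀`.  Proof: a collinearity `F • z = G • z₀` with `F, G ≠ 0`
(`CccOneCollinearMu.exists_collinear_ne_zero`); the collinearity identity gives `ℓ_𝔮(Λ/(F)) = ℓ_𝔮(Λ/(G))` off `(p)`
(finite cancellation); the UFD dictionary `Module.charIdeal_mul_span_pow_eq_of_lengthAt_eq` turns this into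
`(F)·(p)^i = (G)·(p)^{i'}`, i.e. `F·p^i·u = G·p^{i'}` for a unit `u`; torsion-freeness cancels `F`.
[cite: Kato2004Asterisque, Thm. 12.4 (2) (p. 221)] [cite: Washington1997, §13.2] [cite: NeukirchSchmidtWingberg2008, Ch. V §3] -/
theorem exists_pow_smul_eq_units_mul_pow_smul_of_lengthAt_eq (hKc : K.IsCyclotomic) (hγ : K.IsTopGenerator γ)
    (hrank : Module.rank (IwasawaAlgebra p) I.H = 1) {z z₀ : I.H} (hz : z ≠ 0) (hz₀ : z₀ ≠ 0)
    (h : ∀ 𝔮 : PrimeSpectrum (IwasawaAlgebra p), 𝔮.asIdeal.height = 1 → (p : IwasawaAlgebra p) ∉ 𝔮.asIdeal →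
      Module.lengthAt (IwasawaAlgebra p) (I.H ⧸ Submodule.span (IwasawaAlgebra p) {z}) 𝔮 =
        Module.lengthAt (IwasawaAlgebra p) (I.H ⧸ Submodule.span (IwasawaAlgebra p) {z₀}) 𝔮) :
    ∃ (u : (IwasawaAlgebra p)ˣ) (a b : ℕ),
      ((p : IwasawaAlgebra p) ^ a) • z = ((u : IwasawaAlgebra p) * (p : IwasawaAlgebra p) ^ b) • z₀ := by
  haveI := I.isTorsionFree hγ
  haveI : Module.Finite (IwasawaAlgebra p) I.H := IwasawaH1Data.module_finite_of_isCyclotomic hKc hγ I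
  obtain ⟨F, G, hF, hG, hFG⟩ := CccOneCollinearMu.exists_collinear_ne_zero I hγ hrank hz hz₀
  -- the quotient by `z₀` is finitely generated torsion, so its local lengths at height-one primes are finite
  have hAt : Module.IsTorsion (IwasawaAlgebra p) (I.H ⧸ Submodule.span (IwasawaAlgebra p) {z₀}) :=
    CccOneCollinearMu.isTorsion_quotient_span_of_rank_eq_one I hγ hrank hz₀
  obtain ⟨s, hs, hs0⟩ := Submodule.annihilator_top_inter_nonZeroDivisors hAt
  -- `ℓ_𝔮(Λ/(F)) = ℓ_𝔮(Λ/(G))` at every height-one `𝔮 ∌ p`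
  have hFGlen : ∀ 𝔮 : PrimeSpectrum (IwasawaAlgebra p), 𝔮.asIdeal.height = 1 →
      (p : IwasawaAlgebra p) ∉ 𝔮.asIdeal →
      Module.lengthAt (IwasawaAlgebra p) (IwasawaAlgebra p ⧸ Ideal.span {F}) 𝔮 =
        Module.lengthAt (IwasawaAlgebra p) (IwasawaAlgebra p ⧸ Ideal.span {G}) 𝔮 := by
    intro 𝔮 h1 hp𝔮
    have key := CccOneCollinearMu.lengthAt_add_eq_of_collinear I hγ hz hz₀ hFG 𝔮
    rw [h 𝔮 h1 hp𝔮] at key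
    have hfin : Module.lengthAt (IwasawaAlgebra p) (I.H ⧸ Submodule.span (IwasawaAlgebra p) {z₀}) 𝔮 ≠ ⊤ :=
      Module.lengthAt_ne_top_of_isTorsionBy (nonZeroDivisors.ne_zero hs0)
        (fun m => Submodule.mem_annihilator.mp hs m Submodule.mem_top) 𝔮 (le_of_eq h1)
    exact (WithTop.add_right_inj hfin).mp key
  -- read as an equality of characteristic ideals up to powers of `(p)`
  have hpC : (p : IwasawaAlgebra p) = PowerSeries.C (p : ℤ_[p]) := (map_natCast (PowerSeries.C (R := ℤ_[p])) p).symm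
  have hpP : Prime (p : IwasawaAlgebra p) := by rw [hpC]; exact IwasawaAlgebra.prime_C p
  have hFt : Module.IsTorsion (IwasawaAlgebra p) (IwasawaAlgebra p ⧸ Ideal.span {F}) := by
    intro x
    refine ⟨⟨F, mem_nonZeroDivisors_of_ne_zero hF⟩, ?_⟩
    obtain ⟨r, rfl⟩ := Ideal.Quotient.mk_surjective x
    change F • Ideal.Quotient.mk (Ideal.span {F}) r = 0
    rw [← Ideal.Quotient.mk_eq_mk, ← Submodule.Quotient.mk_smul, Submodule.Quotient.mk_eq_zero, smul_eq_mul]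
    exact Ideal.mul_mem_right _ _ (Ideal.subset_span (Set.mem_singleton _))
  have hGt : Module.IsTorsion (IwasawaAlgebra p) (IwasawaAlgebra p ⧸ Ideal.span {G}) := by
    intro x
    refine ⟨⟨G, mem_nonZeroDivisors_of_ne_zero hG⟩, ?_⟩
    obtain ⟨r, rfl⟩ := Ideal.Quotient.mk_surjective x
    change G • Ideal.Quotient.mk (Ideal.span {G}) r = 0
    rw [← Ideal.Quotient.mk_eq_mk, ← Submodule.Quotient.mk_smul, Submodule.Quotient.mk_eq_zero, smul_eq_mul]
    exact Ideal.mul_mem_right _ _ (Ideal.subset_span (Set.mem_singleton _))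
  obtain ⟨i, i', hch⟩ := Module.exists_charIdeal_mul_span_pow_eq_of_lengthAt_eq hFt hGt hpP hFGlen
  rw [BurungaleTian2026.charIdeal_quotient_span_singleton hF, BurungaleTian2026.charIdeal_quotient_span_singleton hG,
    Ideal.span_singleton_pow, Ideal.span_singleton_pow, Ideal.span_singleton_mul_span_singleton,
    Ideal.span_singleton_mul_span_singleton, Ideal.span_singleton_eq_span_singleton] at hch
  obtain ⟨u, hu⟩ := hch
  -- `hu : F * p^i * u = G * p^i'`; cancel `F` in `𝐇¹_Γ` (torsion-free)
  refine ⟨u, i', i, ?_⟩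
  have key : F • (((p : IwasawaAlgebra p) ^ i') • z) =
      F • ((((u : IwasawaAlgebra p)) * (p : IwasawaAlgebra p) ^ i) • z₀) := by
    calc F • (((p : IwasawaAlgebra p) ^ i') • z)
        = ((p : IwasawaAlgebra p) ^ i') • (F • z) := smul_comm _ _ _
      _ = ((p : IwasawaAlgebra p) ^ i') • (G • z₀) := by rw [hFG]
      _ = (G * (p : IwasawaAlgebra p) ^ i') • z₀ := by rw [mul_comm, mul_smul]
      _ = (F * (p : IwasawaAlgebra p) ^ i * (u : IwasawaAlgebra p)) • z₀ := by rw [hu]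
      _ = F • ((((u : IwasawaAlgebra p)) * (p : IwasawaAlgebra p) ^ i) • z₀) := by
          rw [mul_assoc, mul_smul, mul_comm ((p : IwasawaAlgebra p) ^ i) (u : IwasawaAlgebra p)]
  exact (smul_right_injective I.H hF) key

end H1

/-! ## The `η`-frame (as in the companion file) -/

section Frame

variable (hp : p ≠ 2) (K₀ : Type) [Field K₀] [NumberField K₀]
  [IsCyclotomicExtension {p} ℚ K₀] [(galRange (K := ℚ) K₀).Normal]
  (η : absoluteGaloisGroup ℚ →* ℤˣ) (hη : ∀ σ ∈ galRange (K := ℚ) K₀, η σ = 1) (hη1 : η ≠ 1)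
  (V : WeierstrassCurve ℚ) [V.IsElliptic] [V.IsGloballyMinimal] {N : ℕ} [NeZero N]
  {f : CuspForm (Gamma0 N) 2} (hCM : V.HasCM) (hgood : V.HasGoodReductionAtPrime p)
  (hap : V.frobeniusTrace p = 0) (hf : IsNewformOf V f) (ϖ : ℚ)
  (hϖ : if Even (p / 2) then (ϖ : ℝ) * V.realPeriodRat = plusPeriod f
    else (ϖ : ℝ) * V.imaginaryPeriodRat = minusPeriod f)
  (κ : ZpExtension ℚ p) (γ : absoluteGaloisGroup ℚ) (hκ : κ.IsCyclotomic) (hγ : κ.IsTopGenerator γ)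
  (hγK : γ ∈ galRange (K := ℚ) K₀) (hvar : IsCyclotomicVariable p γ)
  (W : WeierstrassCurve ℚ) [W.IsElliptic] [ContinuousSMul ℤ_[p] (W.tateModule p)]
  (I : Kato2004.IwasawaH1Data W p κ γ) (FB : W.FineSelmerDualData κ γ)
  (P : Kobayashi2003.EtaColemanPoitouTateData p K₀ η V f ϖ κ γ W I FB)

include hp hη hη1 hCM hgood hap hf hϖ hκ hγ hγK hvar

/-! ## §2 The `ι`-symmetry of `X₀(W/ℚ_∞)` off `(p)` + `rank_Λ 𝐇¹_Γ = 1` give stub 2c-T1's proportionality -/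

/-- **OFF-`(p)` EQUALITY of the two zeta lines from the `ι`-symmetry of `X₀(W/ℚ_∞)` (kernel).** Same frame, `W` CM and
globally minimal, granted 19867 and Burungale–Tian for `W`: if `ℓ_𝔮(X₀(FB)) = ℓ_{ι𝔮}(X₀(FB))` at every height-one
`𝔮 ≠ (p)`, then `ℓ_𝔮(𝐇¹_Γ ⧸ Λ∙z₀) = ℓ_𝔮(𝐇¹_Γ ⧸ Λ∙P.z)` at every height-one `𝔮 ≠ (p)` for every admissible `z₀` (companion §2 + §1
at `𝔮` and `ι𝔮`). [cite: BurungaleTian2026, Thm. 2.6 (p. 5)] [cite: Kobayashi2003, proof of Thm. 7.4 (p. 13)]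
[cite: Greenberg1989, §0 (pp. 101–102)] -/
theorem lengthAt_quotient_admissible_eq_lengthAt_quotient_kobayashiClass_of_fine_comap_invol [W.IsGloballyMinimal]
    (hBT : Kato2004.BurungaleTian2026_lengthEq_offMu_of_hasCM) (hF : PublishedInputsEtaUpToP) (hWCM : W.HasCM)
    (z₀ : I.H) (hz₀ : IsAdmissibleZetaClass W p κ hκ I z₀)
    (hsym : ∀ 𝔮 : PrimeSpectrum (IwasawaAlgebra p), 𝔮.asIdeal.height = 1 → 𝔮.asIdeal ≠ augIdealP p →
      Module.lengthAt (IwasawaAlgebra p) FB.X 𝔮 =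
        Module.lengthAt (IwasawaAlgebra p) FB.X (PrimeSpectrum.comap (invol p).toRingHom 𝔮))
    (𝔮 : PrimeSpectrum (IwasawaAlgebra p)) (h𝔮 : 𝔮.asIdeal.height = 1) (hne : 𝔮.asIdeal ≠ augIdealP p) :
    Module.lengthAt (IwasawaAlgebra p) (I.H ⧸ Submodule.span (IwasawaAlgebra p) {z₀}) 𝔮 =
      Module.lengthAt (IwasawaAlgebra p) (I.H ⧸ Submodule.span (IwasawaAlgebra p) {P.z}) 𝔮 := by
  rw [lengthAt_quotient_admissible_eq_lengthAt_comap_invol_quotient_kobayashiClass hp K₀ η hη hη1 V hCM hgood hap hf ϖ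
      hϖ κ γ hκ hγ hγK hvar W I FB P hBT hF hWCM z₀ hz₀ 𝔮 h𝔮 hne,
    ← lengthAt_fine_eq_lengthAt_quotient_kobayashiClass_of_ne_augIdealP hp K₀ η hη hη1 V hCM hgood hap hf ϖ hϖ κ γ hκ
      hγ hγK hvar W I FB P hF _ (height_comap_invol_eq_one 𝔮 h𝔮) (comap_invol_ne_augIdealP 𝔮 hne),
    ← hsym 𝔮 h𝔮 hne,
    lengthAt_fine_eq_lengthAt_quotient_kobayashiClass_of_ne_augIdealP hp K₀ η hη hη1 V hCM hgood hap hf ϖ hϖ κ γ hκ hγ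
      hγK hvar W I FB P hF 𝔮 h𝔮 hne]

/-- **Stub 2c-T1's conclusion at the pin FROM the `ι`-symmetry of `X₀(W/ℚ_∞)` off `(p)` (kernel).** Same frame, `W` CM and
globally minimal, `rank_Λ 𝐇¹_Γ(T_pW) = 1` (on the rows: Mordell–Weil rank one + `Ш[p^∞]` finite), granted 19867 and
Burungale–Tian for `W`: if `char X₀(FB)` is `ι`-symmetric away from `(p)` and SOME admissible class `z₀` lives on the pin, then
there are an ADMISSIBLE `z₁` and `a b : ℕ` with `(p:Λ)^a • P.z = (p:Λ)^b • z₁` — the registered conclusion of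
`stub_zetaLinesProportionalIstarZero` at `(FB, P)`.  Proof: the off-`(p)` equality above, §1's element-level lemma
`exists_pow_smul_eq_units_mul_pow_smul_of_lengthAt_eq` (rank one, UFD), and absorption of the unit into the admissible class
(`IsAdmissibleZetaClass.units_smul`).  TOGETHER WITH companion §3: granted the line's print stub, 2c-T1 at a pin ⟺ the `ι`-symmetry of
`X₀(W/ℚ_∞) ⊗ ℚ` (for the key-`γ` data over `κ`). [cite: Kato2004Asterisque, Thm. 12.4 (2), Thm. 12.5 (1) (p. 221), Conj. 12.10 (p. 224)]
[cite: Kobayashi2003, Thm. 6.3 (p. 11), proof of Thm. 7.4 (p. 13)] [cite: BurungaleTian2026, Thm. 2.6 (p. 5)]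
[cite: Greenberg1989, §0 (pp. 101–102)] [cite: Washington1997, §13.2] -/
theorem exists_admissible_pow_smul_eq_of_fine_comap_invol [W.IsGloballyMinimal]
    (hBT : Kato2004.BurungaleTian2026_lengthEq_offMu_of_hasCM) (hF : PublishedInputsEtaUpToP) (hWCM : W.HasCM)
    (hrank : Module.rank (IwasawaAlgebra p) I.H = 1)
    (z₀ : I.H) (hz₀ : IsAdmissibleZetaClass W p κ hκ I z₀)
    (hsym : ∀ 𝔮 : PrimeSpectrum (IwasawaAlgebra p), 𝔮.asIdeal.height = 1 → 𝔮.asIdeal ≠ augIdealP p →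
      Module.lengthAt (IwasawaAlgebra p) FB.X 𝔮 =
        Module.lengthAt (IwasawaAlgebra p) FB.X (PrimeSpectrum.comap (invol p).toRingHom 𝔮)) :
    ∃ (z₁ : I.H) (a b : ℕ), IsAdmissibleZetaClass W p κ hκ I z₁ ∧
      ((p : IwasawaAlgebra p) ^ a) • P.z = ((p : IwasawaAlgebra p) ^ b) • z₁ := by
  have hcz : P.colPlus P.z ≠ 0 := CccOnePackageRigidity.colPlus_z_ne_zero hp K₀ η V hgood hf ϖ hϖ κ γ W I P
  have hPz : P.z ≠ 0 := by
    intro h0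
    exact hcz (by rw [h0, map_zero])
  have hz₀0 : z₀ ≠ 0 := CccOneCollinearMu.ne_zero_of_isAdmissibleZetaClass I hγ hz₀
  have hlen : ∀ 𝔮 : PrimeSpectrum (IwasawaAlgebra p), 𝔮.asIdeal.height = 1 → (p : IwasawaAlgebra p) ∉ 𝔮.asIdeal →
      Module.lengthAt (IwasawaAlgebra p) (I.H ⧸ Submodule.span (IwasawaAlgebra p) {P.z}) 𝔮 =
        Module.lengthAt (IwasawaAlgebra p) (I.H ⧸ Submodule.span (IwasawaAlgebra p) {z₀}) 𝔮 :=
    fun 𝔮 h1 hp𝔮 => (lengthAt_quotient_admissible_eq_lengthAt_quotient_kobayashiClass_of_fine_comap_invol hp K₀ η hη hη1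
      V hCM hgood hap hf ϖ hϖ κ γ hκ hγ hγK hvar W I FB P hBT hF hWCM z₀ hz₀ hsym 𝔮 h1
      ((natCast_not_mem_iff_ne_augIdealP 𝔮 h1).mp hp𝔮)).symm
  obtain ⟨u, a, b, hab⟩ := exists_pow_smul_eq_units_mul_pow_smul_of_lengthAt_eq I hκ hγ hrank hPz hz₀0 hlen
  refine ⟨(u : IwasawaAlgebra p) • z₀, a, b, hz₀.units_smul u, ?_⟩
  rw [hab, mul_comm, mul_smul]

end Frame

/-! ## §3 On the rows of the type `(p, I₀*)`, `p ≥ 5` -/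

open Summit.BirchSwinnertonDyer.Rank1Residual.X12.O10 Summit.BirchSwinnertonDyer.Rank1Residual.Additive in
/-- **Row reading of the converse (kernel).** On a row `(W, p)` of the signed type `(p, I₀*)`, `p ≥ 5`, of analytic rank one, in
every `η`-frame of the Kobayashi package fact and at every pin `I : 𝐇¹_Γ(T_pW)`: IF `char X₀(W/ℚ_∞)` is `ι`-symmetric away from
`(p)` for the key-`γ` data over `κ`, THEN stub 2c-T1's registered conclusion holds at `I`
(`∃ FB₁ P₁ z₁ a b, IsAdmissibleZetaClass … z₁ ∧ (p:Λ)^a • P₁.z = (p:Λ)^b • z₁`), granted the line's print conjuncts: the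
package fact `Kobayashi2003.thm62_63_73_etaColemanPoitouTate` (`.2.2.2.2.2.2.1`, the package `P₁` on `(I, FB₁)`), F-CM
`Kato2004.exists_isAdmissibleZetaClass_of_hasCM_of_irreducible` (`.2.2.1`, an admissible class on `I`: `W` CM, `p` inert,
`W[p]` irreducible by the row lemma `hasIrreducibleModPGaloisRep_of_hasSignedLocalType_IstarZero`), GZK
`rank_eq_analyticRank_of_analyticRank_le_one` (`stub_printInputsInert.2`: Mordell–Weil rank one, `Ш` finite, so `rank_Λ 𝐇¹_Γ = 1`
by `CccOneCollinearMu.rank_eq_one_of_isAdmissibleZetaClass`), BT26-for-`W` (`.2.2.2.1`) and 19867 (`.2.2.2.2.2.1`).  With companion §4: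
on this line, granted its print stub, **stub 2c-T1 ⟺ the `ι`-symmetry of `char X₀(W/ℚ_∞) ⊗ ℚ` on the rows** — a statement
about ONE standard Iwasawa module of `W`, with no package, class or frame in it.  Nothing asserted; 19223 OPEN.
[cite: Kato2004Asterisque, Prop. 15.21 (p. 266), Thm. 12.4 (2), Thm. 12.5 (1) (p. 221), §14.9 (14.9.3) (p. 240)]
[cite: Kobayashi2003, Thm. 6.2–6.3 (p. 11), Thm. 7.3 i), Cor. 7.2 (p. 13)] [cite: BurungaleTian2026, Thm. 2.6 (p. 5)]
[cite: Greenberg1989, §0 (pp. 101–102)] [cite: Darmon2004, Thm. 3.22] [cite: Serre1972, §1.11 Prop. 12] -/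
theorem stub2cT1_at_of_fine_comap_invol_onType_IstarZero
    (hBT : Kato2004.BurungaleTian2026_lengthEq_offMu_of_hasCM) (hF : PublishedInputsEtaUpToP)
    (hT : Kobayashi2003.thm62_63_73_etaColemanPoitouTate)
    (hFCM : Kato2004.exists_isAdmissibleZetaClass_of_hasCM_of_irreducible)
    (hGZK : rank_eq_analyticRank_of_analyticRank_le_one)
    (p : ℕ) [Fact p.Prime] (hp5 : 5 ≤ p) (W : WeierstrassCurve ℚ) [W.IsElliptic] [W.IsGloballyMinimal]
    (hTy : HasSignedLocalType W p (.Istar 0)) (hr : W.analyticRank = 1)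
    (K₀ : Type) [Field K₀] [NumberField K₀] [IsCyclotomicExtension {p} ℚ K₀] [(galRange (K := ℚ) K₀).Normal]
    (η : absoluteGaloisGroup ℚ →* ℤˣ) (hη : ∀ σ ∈ galRange (K := ℚ) K₀, η σ = 1) (hη1 : η ≠ 1)
    (V : WeierstrassCurve ℚ) [V.IsElliptic] [V.IsGloballyMinimal] {N : ℕ} [NeZero N]
    {f : CuspForm (Gamma0 N) 2} (hCM : V.HasCM) (hgood : V.HasGoodReductionAtPrime p)
    (hap : V.frobeniusTrace p = 0) (hf : IsNewformOf V f) (ϖ : ℚ)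
    (hϖ : if Even (p / 2) then (ϖ : ℝ) * V.realPeriodRat = plusPeriod f
      else (ϖ : ℝ) * V.imaginaryPeriodRat = minusPeriod f)
    (κ : ZpExtension ℚ p) (hκ : κ.IsCyclotomic) (γ : absoluteGaloisGroup ℚ) (hγ : κ.IsTopGenerator γ)
    (hγK : γ ∈ galRange (K := ℚ) K₀) (hvar : IsCyclotomicVariable p γ)
    (C : VariableChange ℚ) (hC : C • W.quadraticTwist ((-1) ^ (p / 2) * p) = V) :
    letI : ContinuousSMul ℤ_[p] (W.tateModule p) := TateModule.continuousSMul_padicInt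
    ∀ (I : Kato2004.IwasawaH1Data W p κ γ),
      (∀ (FB : W.FineSelmerDualData κ γ) (𝔮 : PrimeSpectrum (IwasawaAlgebra p)), 𝔮.asIdeal.height = 1 →
        𝔮.asIdeal ≠ augIdealP p →
          Module.lengthAt (IwasawaAlgebra p) FB.X 𝔮 =
            Module.lengthAt (IwasawaAlgebra p) FB.X (PrimeSpectrum.comap (invol p).toRingHom 𝔮)) →
      ∃ (FB₁ : W.FineSelmerDualData κ γ) (P₁ : Kobayashi2003.EtaColemanPoitouTateData p K₀ η V f ϖ κ γ W I FB₁)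
        (z₁ : I.H) (a b : ℕ), Kato2004.IsAdmissibleZetaClass W p κ hκ I z₁ ∧
          ((p : IwasawaAlgebra p) ^ a) • P₁.z = ((p : IwasawaAlgebra p) ^ b) • z₁ := by
  intro I hsym
  letI : ContinuousSMul ℤ_[p] (W.tateModule p) := TateModule.continuousSMul_padicInt
  have hp2 : p ≠ 2 := by omega
  -- the package on `(I, FB₁)` (Kobayashi package fact)
  obtain ⟨FB₁⟩ := W.nonempty_fineSelmerDualData κ hγ
  obtain ⟨P₁⟩ := hT p K₀ η hη hη1 V hp2 hgood hap hf ϖ hϖ κ γ hκ hγ hγK hvar W C hC I FB₁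
  -- an admissible class on `I` (F-CM through the row lemma)
  have hirr := StrictCount.hasIrreducibleModPGaloisRep_of_hasSignedLocalType_IstarZero W p hp5 hTy
  obtain ⟨z₀, hz₀⟩ := hFCM W p κ γ hκ hγ hp2 hTy.1 hTy.2.1.1 hirr I
  -- GZK on the row: `rank_Λ 𝐇¹_Γ = 1`
  obtain ⟨hmw, hfinSha⟩ := hGZK W (by rw [hr])
  have hrk : W.mordellWeilRank = 1 := by rw [hmw, hr]
  haveI : Finite W.sha := hfinSha
  have hsha : Finite (AddCommGroup.primaryComponent W.sha p) := inferInstance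
  have hrank := CccOneCollinearMu.rank_eq_one_of_isAdmissibleZetaClass I hγ hrk hsha hz₀
  obtain ⟨z₁, a, b, hz₁, hab⟩ := exists_admissible_pow_smul_eq_of_fine_comap_invol hp2 K₀ η hη hη1 V hCM hgood hap hf ϖ
    hϖ κ γ hκ hγ hγK hvar W I FB₁ P₁ hBT hF hTy.1 hrank z₀ hz₀ (hsym FB₁)
  exact ⟨FB₁, P₁, z₁, a, b, hz₁, hab⟩

open Summit.BirchSwinnertonDyer.Rank1Residual.X12.O10 in
/-- **THE EQUIVALENCE on a row and an `η`-frame (kernel): stub 2c-T1 at every pin ⟺ the `ι`-symmetry of `X₀(W/ℚ_∞)` off `(p)`**,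
granted the line's print conjuncts BT26-for-`W`, 19867, the Kobayashi package fact, F-CM and GZK.  `→`: companion §4 at one pin
(`Kato2004.nonempty_iwasawaH1Data_holds`); `←`: §3.  This is the certificate for the census recommendation «reshape 2c-T1 ↦ (SYM)»:
same strength on the rows, and (SYM) speaks of the single module `X₀(W/ℚ_∞)`.  Nothing asserted; no stub closed; 19223 OPEN.
[cite: Kato2004Asterisque, Thm. 12.4 (2), Thm. 12.5 (1) (p. 221), Conj. 12.10 (p. 224), Prop. 15.21 (p. 266)]
[cite: Kobayashi2003, Thm. 6.2–6.3 (p. 11), Thm. 7.3 i), Cor. 7.2, proof of Thm. 7.4 (p. 13)] [cite: BurungaleTian2026, Thm. 2.6 (p. 5)]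
[cite: Greenberg1989, §0 (pp. 101–102)] [cite: Darmon2004, Thm. 3.22] -/
theorem stub2cT1_iff_fine_comap_invol_onType_IstarZero
    (hBT : Kato2004.BurungaleTian2026_lengthEq_offMu_of_hasCM) (hF : PublishedInputsEtaUpToP)
    (hT : Kobayashi2003.thm62_63_73_etaColemanPoitouTate)
    (hFCM : Kato2004.exists_isAdmissibleZetaClass_of_hasCM_of_irreducible)
    (hGZK : rank_eq_analyticRank_of_analyticRank_le_one)
    (p : ℕ) [Fact p.Prime] (hp5 : 5 ≤ p) (W : WeierstrassCurve ℚ) [W.IsElliptic] [W.IsGloballyMinimal]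
    (hTy : HasSignedLocalType W p (.Istar 0)) (hr : W.analyticRank = 1)
    (K₀ : Type) [Field K₀] [NumberField K₀] [IsCyclotomicExtension {p} ℚ K₀] [(galRange (K := ℚ) K₀).Normal]
    (η : absoluteGaloisGroup ℚ →* ℤˣ) (hη : ∀ σ ∈ galRange (K := ℚ) K₀, η σ = 1) (hη1 : η ≠ 1)
    (V : WeierstrassCurve ℚ) [V.IsElliptic] [V.IsGloballyMinimal] {N : ℕ} [NeZero N]
    {f : CuspForm (Gamma0 N) 2} (hCM : V.HasCM) (hgood : V.HasGoodReductionAtPrime p)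
    (hap : V.frobeniusTrace p = 0) (hf : IsNewformOf V f) (ϖ : ℚ)
    (hϖ : if Even (p / 2) then (ϖ : ℝ) * V.realPeriodRat = plusPeriod f
      else (ϖ : ℝ) * V.imaginaryPeriodRat = minusPeriod f)
    (κ : ZpExtension ℚ p) (hκ : κ.IsCyclotomic) (γ : absoluteGaloisGroup ℚ) (hγ : κ.IsTopGenerator γ)
    (hγK : γ ∈ galRange (K := ℚ) K₀) (hvar : IsCyclotomicVariable p γ)
    (C : VariableChange ℚ) (hC : C • W.quadraticTwist ((-1) ^ (p / 2) * p) = V) :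
    letI : ContinuousSMul ℤ_[p] (W.tateModule p) := TateModule.continuousSMul_padicInt
    (∀ (I : Kato2004.IwasawaH1Data W p κ γ),
      ∃ (FB₁ : W.FineSelmerDualData κ γ) (P₁ : Kobayashi2003.EtaColemanPoitouTateData p K₀ η V f ϖ κ γ W I FB₁)
        (z₁ : I.H) (a b : ℕ), Kato2004.IsAdmissibleZetaClass W p κ hκ I z₁ ∧
          ((p : IwasawaAlgebra p) ^ a) • P₁.z = ((p : IwasawaAlgebra p) ^ b) • z₁) ↔
    (∀ (FB : W.FineSelmerDualData κ γ) (𝔮 : PrimeSpectrum (IwasawaAlgebra p)), 𝔮.asIdeal.height = 1 →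
      𝔮.asIdeal ≠ augIdealP p →
        Module.lengthAt (IwasawaAlgebra p) FB.X 𝔮 =
          Module.lengthAt (IwasawaAlgebra p) FB.X (PrimeSpectrum.comap (invol p).toRingHom 𝔮)) := by
  letI : ContinuousSMul ℤ_[p] (W.tateModule p) := TateModule.continuousSMul_padicInt
  constructor
  · intro hT1 FB 𝔮 h𝔮 hne
    obtain ⟨I⟩ := Kato2004.nonempty_iwasawaH1Data_holds W p κ γ hκ hγ
    exact lengthAt_fine_eq_comap_invol_onType_IstarZero_of_stub2cT1_at hBT hF p hp5 W hTy K₀ η hη hη1 V hCM hgood hap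
      hf ϖ hϖ κ hκ γ hγ hγK hvar I (hT1 I) FB 𝔮 h𝔮 hne
  · intro hsym I
    exact stub2cT1_at_of_fine_comap_invol_onType_IstarZero hBT hF hT hFCM hGZK p hp5 W hTy hr K₀ η hη hη1 V hCM hgood hap
      hf ϖ hϖ κ hκ γ hγ hγK hvar C hC I hsym

end Summit.BirchSwinnertonDyer.BirchSwinnertonDyer.Theorems.CccOneOffMuComparisonConverse

end
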